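/- Copyright: ym-fleet seat `ym-infvol-p3` (prover, g4), for crux `HistoryTail` ∕ `HistoryTailL` (stmt-QuantumFields-18916 ∕
19936) of route `UnitScaleTilt`, STUB 3 «chessboard ∕ reflection positivity».  Released under the licence of the surrounding project. -/
import Summits.QuantumFields.YangMills.Theorems.UnitScaleTiltHistoryTailChessboardFamily

/-!
# Chessboard for ONE top-level plaquette of the Gibbs tower, file 4b: the separated family in `ℓ^∞` (coordinate) form

Support file (helper lemmas) for STUB 3 of crux `HistoryTail` → `HistoryTailL`.  File 4 (`…ChessboardFamily`) exports the
mirror family through an arbitrary top plaquette with the `ℓ¹` torus separation `Site.tdist ≥ M − 1`.  The family is in fact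
separated COORDINATEWISE: two copies in different cubes differ, in SOME direction, by at least `M − 1` in the cyclic distance
of that coordinate (both `(x_μ − x'_μ).val` and `(x'_μ − x_μ).val` are `≥ M − 1`, equivalently `|(x_μ − x'_μ).valMinAbs| ≥ M − 1`)
— the `ℓ^∞` form used by box-disjointness arguments (e.g. the crux-idea card `chessboard-collar-delocalisation`'s `SepAtLeast`)
without the factor `d` an `ℓ¹` bound costs.  General `P : Params`.

WHAT.  §1 `min_val_eq_natAbs_valMinAbs` (the two cyclic representatives vs Mathlib's `valMinAbs`); §2
**`exists_separated_mirror_family_sup`** = file 4's `exists_separated_mirror_family` with the additional coordinate clause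
`∀ c ≠ c', ∃ μ, M − 1 ≤ |((q c).src μ − (q c').src μ).valMinAbs|` (and the `ℓ¹` clause kept).

HONEST SCOPE.  Finite-torus bookkeeping over files 1–4; nothing of Bałaban's estimates; the crux and its route stay CONDITIONAL
on the (α) input package.  Not infinite volume, not a gap, not Clay.
-/

namespace Summit.QuantumFields.YangMills.Theorems.HistoryTailChessboardFamilySup

open MeasureTheory Finset
open Literature.Barriers.CriticalPhenomena.NonGibbs
open Literature.MathematicalPhysics.QuantumFieldTheory
open Literature.MathematicalPhysics.QuantumFieldTheory.Balaban1983to89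
open BlockAveraging
open Summit.QuantumFields.BalabanUV.T4Continuum
open HistoryChessboardEventsCubes HistoryChessboardEventsCubeSites HistoryChessboardPlaquetteBox
open Summit.QuantumFields.YangMills.Theorems.HistoryTailChessboardMirror
open Summit.QuantumFields.YangMills.Theorems.HistoryTailChessboardOnePlaquette
open Summit.QuantumFields.YangMills.Theorems.HistoryTailChessboardFamily

noncomputable section

/-! ## §1 Cyclic representatives -/

/-- for `a ≠ 0` in `ZMod n`, `min a.val (−a).val` is the absolute value of the centred representative. [folklore] -/
theorem min_val_eq_natAbs_valMinAbs {n : ℕ} [NeZero n] {a : ZMod n} (ha : a ≠ 0) :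
    min a.val (-a).val = a.valMinAbs.natAbs := by
  rw [ZMod.valMinAbs_natAbs_eq_min, ZMod.neg_val, if_neg ha]

/-- … hence a common lower bound of the two cyclic representatives bounds `|valMinAbs|` from below. [folklore] -/
theorem le_natAbs_valMinAbs_of_le {n : ℕ} [NeZero n] {a : ZMod n} {D : ℕ} (h1 : D ≤ a.val) (h2 : D ≤ (-a).val) :
    D ≤ a.valMinAbs.natAbs := by
  by_cases ha : a = 0
  · subst ha
    rw [ZMod.val_zero] at h1
    exact (Nat.le_zero.1 h1).symm ▸ Nat.zero_le _
  · rw [← min_val_eq_natAbs_valMinAbs ha]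
    exact le_min h1 h2

/-! ## §2 The separated mirror family with the coordinate (`ℓ^∞`) clause -/

section Family

variable {P : Params} {K M N : ℕ} {n : ℕ} [NeZero n] [NeZero N]

/-- coordinatewise separation of the mirror copies of a centred plaquette: for `c ≠ c'` some coordinate of the base
points differs by at least `M − 1` in cyclic distance (file 4's `le_val_mirrorSrc_sub`, both ways). [folklore] -/
theorem exists_coord_sep_mirror (h : P.sitesPerDir K = M * N) (hN : Even N) {p : Plaq P K}
    (hp : ∀ j : Fin P.d, baseOffset M p j + extent p j < M)
    (hcen : ∀ j : Fin P.d, M ≤ 2 * baseOffset M p j + extent p j + 2 ∧ 2 * baseOffset M p j + extent p j ≤ M)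
    {c c' : BlockIdx P.d N} (hcc' : c ≠ c') :
    ∃ μ : Fin P.d, M - 1 ≤ ((mirror h hN p c).src μ - (mirror h hN p c').src μ).valMinAbs.natAbs := by
  obtain ⟨j, hj⟩ := Function.ne_iff.1 hcc'
  refine ⟨j, le_natAbs_valMinAbs_of_le ?_ ?_⟩
  · rw [mirror_src, mirror_src]
    exact le_val_mirrorSrc_sub h hN hp hcen hj
  · rw [mirror_src, mirror_src, neg_sub]
    exact le_val_mirrorSrc_sub h hN hp hcen (Ne.symm hj)

/-- **A SEPARATED MIRROR FAMILY THROUGH ANY TOP PLAQUETTE, `ℓ^∞` FORM** — file 4's `exists_separated_mirror_family` with the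
additional clause that two copies in different cubes are `(M − 1)`-separated in SOME coordinate (cyclic distance
`|valMinAbs| ≥ M − 1`), besides the `ℓ¹` clause `tdist ≥ M − 1` and the multiple-reflection bound. [folklore] -/
theorem exists_separated_mirror_family_sup (P : Params) {β : ℝ} (hβ : 0 ≤ β)
    (ℰ : ℕ → LoopAverage (Matrix.specialUnitaryGroup (Fin n) ℂ))
    (hE : ∀ k l, Measurable fun W : Fin (l + 1) → Matrix.specialUnitaryGroup (Fin n) ℂ => (ℰ k).E W)
    (K : ℕ) (hK : K ≤ P.m + P.K) (h : P.sitesPerDir K = M * N) (hN : Even N) (hM : 2 ≤ M)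
    {B : Set ℝ} (hB : MeasurableSet B) (p : Plaq P K) :
    ∃ q : BlockIdx P.d N → Plaq P K, Function.Injective q ∧ (∃ c₀, q c₀ = p) ∧
      (∀ c, (q c).μ = p.μ ∧ (q c).ν = p.ν) ∧
      (∀ c c', c ≠ c' → ∃ μ : Fin P.d, M - 1 ≤ (((q c).src μ - (q c').src μ).valMinAbs).natAbs) ∧
      (∀ c c', c ≠ c' → M - 1 ≤ Site.tdist (q c).src (q c').src) ∧
      (T4GenFunBounds.gibbsMeasure (G := Matrix.specialUnitaryGroup (Fin n) ℂ) P β).real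
          {U | dist1 (GaugeField.plaqHol
            (Averaging.iter (fun k => blockAvg (P := P) (j := k) (ℰ k)) K U) p) ∈ B} ≤
        ((T4GenFunBounds.gibbsMeasure (G := Matrix.specialUnitaryGroup (Fin n) ℂ) P β).real
          {U | ∀ c : BlockIdx P.d N, dist1 (GaugeField.plaqHol
            (Averaging.iter (fun k => blockAvg (P := P) (j := k) (ℰ k)) K U) (q c)) ∈ B}) ^
          ((1 : ℝ) / (N : ℝ) ^ P.d) := by
  set v : Site P K := centreVec M p with hv
  set p' : Plaq P K := p.translate v with hp'_def
  have hoff : ∀ j, baseOffset M p' j = centreOffset M p j := fun j => baseOffset_translate_centreVec h p j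
  have hp' : ∀ j : Fin P.d, baseOffset M p' j + extent p' j < M := fun j => by
    rw [hoff, hp'_def, extent_translate]; exact (centreOffset_bounds hM p j).1
  have hcen : ∀ j : Fin P.d, M ≤ 2 * baseOffset M p' j + extent p' j + 2 ∧ 2 * baseOffset M p' j + extent p' j ≤ M :=
    fun j => by rw [hoff, hp'_def, extent_translate]; exact (centreOffset_bounds hM p j).2
  refine ⟨fun c => (mirror h hN p' c).translate (-v), ?_, ⟨cubeOf M N p'.src, ?_⟩, fun c => ⟨rfl, rfl⟩, ?_, ?_, ?_⟩
  · intro c c' hcc'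
    apply mirror_injective h hN hp'
    have e : ((mirror h hN p' c).translate (-v)).translate v = ((mirror h hN p' c').translate (-v)).translate v :=
      congrArg (Plaq.translate v) hcc'
    rwa [plaq_translate_translate, plaq_translate_translate, neg_add_cancel, plaq_translate_zero,
      plaq_translate_zero] at e
  · show (mirror h hN p' (cubeOf M N p'.src)).translate (-v) = p
    rw [mirror_cubeOf h hN hp', hp'_def, plaq_translate_translate, add_neg_cancel, plaq_translate_zero]
  · intro c c' hcc'
    obtain ⟨μ, hμ⟩ := exists_coord_sep_mirror h hN hp' hcen hcc'
    refine ⟨μ, ?_⟩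
    show M - 1 ≤ (((mirror h hN p' c).src + -v) μ - ((mirror h hN p' c').src + -v) μ).valMinAbs.natAbs
    rwa [Site.add_apply, Site.add_apply, add_sub_add_right_eq_sub]
  · intro c c' hcc'
    show M - 1 ≤ Site.tdist ((mirror h hN p' c).src + -v) ((mirror h hN p' c').src + -v)
    rw [tdist_add_right]
    exact le_tdist_mirror h hN hp' hcen hcc'
  · have main := gibbs_real_iter_le_rpow_mirror P hβ ℰ hE K hK h hN hB p' hp'
    have hS₁ : MeasurableSet {V : GaugeField P K (Matrix.specialUnitaryGroup (Fin n) ℂ) |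
        dist1 (GaugeField.plaqHol V p) ∈ B} :=
      (RegularGaugeGroup.measurable_dist1.comp (Missing.measurable_plaqHol _)) hB
    have hS₂ : MeasurableSet {V : GaugeField P K (Matrix.specialUnitaryGroup (Fin n) ℂ) | ∀ c : BlockIdx P.d N,
        dist1 (GaugeField.plaqHol V ((mirror h hN p' c).translate (-v))) ∈ B} := by
      have : {V : GaugeField P K (Matrix.specialUnitaryGroup (Fin n) ℂ) | ∀ c : BlockIdx P.d N,
          dist1 (GaugeField.plaqHol V ((mirror h hN p' c).translate (-v))) ∈ B} =
          ⋂ c, {V | dist1 (GaugeField.plaqHol V ((mirror h hN p' c).translate (-v))) ∈ B} := by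
        ext V; simp only [Set.mem_setOf_eq, Set.mem_iInter]
      rw [this]
      exact MeasurableSet.iInter fun c => (RegularGaugeGroup.measurable_dist1.comp (Missing.measurable_plaqHol _)) hB
    have e₁ := gibbs_real_iter_translate P hβ ℰ hE K hS₁ v
    have e₂ := gibbs_real_iter_translate P hβ ℰ hE K hS₂ v
    simp only [Set.mem_setOf_eq, GaugeField.plaqHol_translate, plaq_translate_translate, neg_add_cancel,
      plaq_translate_zero] at e₁ e₂
    rw [← e₁, ← e₂]
    exact main

end Family

end

end Summit.QuantumFields.YangMills.Theorems.HistoryTailChessboardFamilySup
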